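import Summits.QuantumAdvantage.QuantumAdvantage.Theorems.CubicForrelationSignedExactCubicForrelationNotPrBPPStubCubeBlockSumsCube
import Summits.QuantumAdvantage.QuantumAdvantage.Theorems.CubicForrelationSignedExactCubicForrelationNotPrBPPStubNoTrapTemplate

/-!
# Crux `CubicForrelation.SignedExactCubicForrelationNotPrBPP` (stmt-QuantumAdvantage-13932), line `dual-pingpong-frame`
# (classify-then-count cut): stub `stub_cubeBlockSums` (H4) — FRAME CONFINEMENT of closed orthogonal pairs

Support file 2/4 (`--supports stmt-QuantumAdvantage-13932`). For a Maiorana–McFarland template pair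
`b(y', y'') = y'·π(y'') ⊕ h(y'')`, `a(x', x'') = x''·σ(x') ⊕ h(σ x') ⊕ c` (`σ = π⁻¹`, both with quadratic
coordinates, `a`, `b` cubic) and a pair `(S, U)` that is CLOSED for `b` and for `a` (the line's `ClosedF`, verbatim)
and ORTHOGONAL, the abstract frame calculus of the landed no-trap theorem (`NoTrap.flat_of_closed_orth`,
`NoTrap.frame_D3`, `NoTrap.frame_row_mem`) gives:

* `S` is `b`-flat, hence `B_π(s'', s₂'') = 0` on `S'' × S''` (frame third difference of a flat pair); dually
  `B_σ(u', u₂') = 0` on `U' × U'`;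
* the rows of `b` at `s ∈ S` project onto `Im B_π(s'', ·) ⊆ U'`, the rows of `a` at `u ∈ U` onto `Im B_σ(u', ·) ⊆ S''`.

So `B_σ` vanishes identically on `Im B_π(s'', ·)` and `B_π` on `Im B_σ(u', ·)`. Under the BLOCK NONDEGENERACY
hypotheses `nd1`/`nd2` (proved for the `𝔽₈`-cube template in `…StubCubeBlockSumsCube.lean`) this forces `s'' = 0` and
`u' = 0`: **`S ⊆ Y' × 0` and `U ⊆ 0 × X''`** (`frame_confine`). This is the part of the block-sum classification of
closed pairs of cube-type data that the kernel statistics need; no use is made of radical absorption or properness.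
Also here: `exists_block_notin` — a proper `⊕`-closed `S` misses a one-block frame vector `((a)_q, 0)` (the block that
will carry the good vectors).

References: C. Carlet, *Boolean Functions for Cryptography and Coding Theory*, CUP 2021, §5.2 (polar forms),
Prop. 54 (Maiorana–McFarland second derivatives) [Carlet2020]; lead c1, `Lines/dual_pingpong_frame_NT.md` (C1)–(C3). -/

noncomputable section

set_option linter.dupNamespace false -- D-0017: single-problem summit ⇒ `QuantumAdvantage.QuantumAdvantage` by design

namespace Summit.QuantumAdvantage.QuantumAdvantage.Theorems.SignedExactCubicForrelationNotPrBPP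

open Finset
open Literature.Computability.Complexity Literature.Computability.QuantumComplexity
open Literature.Computability.QuantumComplexity.BuzetChailloux (bxor zeroVec bxor_self bxor_comm
  bxor_zeroVec zeroVec_bxor)
open PolarGeometry (bdot_comm bdot_bxor_left bdot_bxor_right exists_append bxor_append)
open NoTrap
open CubeKS

namespace CubeBS

/-- **FRAME CONFINEMENT.** For a template pair `(a, b)` over a permutation `π` with quadratic coordinates on both
sides and a pair `(S, U)` closed for `b`, closed for `a` and orthogonal: if `π` is BLOCK-NONDEGENERATE (`B_σ` cannot
vanish on an image `Im B_π(t, ·)` with `t ≠ 0`, and dually), then `S ⊆ Y' × 0` and `U ⊆ 0 × X''`.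
[cite: Carlet2020, Prop. 54] -/
theorem frame_confine {m : ℕ} (a b : (Fin (m + m) → Bool) → Bool) (π : (Fin m → Bool) ≃ (Fin m → Bool))
    (h : (Fin m → Bool) → Bool) (c : Bool)
    (hπ : ∀ i, IsDegLeFun 2 fun y => π y i) (hσ : ∀ i, IsDegLeFun 2 fun x => π.symm x i)
    (ha : IsDegLeFun 3 a) (hb : IsDegLeFun 3 b)
    (hbdef : ∀ y' y'' : Fin m → Bool, b (Fin.append y' y'') =
      (((Finset.univ.filter fun i => y' i && (π y'') i).card.bodd) ^^ h y''))
    (hadef : ∀ x' x'' : Fin m → Bool, a (Fin.append x' x'') =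
      (((Finset.univ.filter fun i => x'' i && (π.symm x') i).card.bodd) ^^ h (π.symm x') ^^ c))
    (hnd1 : ∀ t : Fin m → Bool, (∀ y y₂ : Fin m → Bool, Bv π.symm (Bv π t y) (Bv π t y₂) = zeroVec) → t = zeroVec)
    (hnd2 : ∀ u : Fin m → Bool, (∀ x x₂ : Fin m → Bool, Bv π (Bv π.symm u x) (Bv π.symm u x₂) = zeroVec) → u = zeroVec)
    (S U : Finset (Fin (m + m) → Bool))
    (hcb : (∀ s ∈ S, ∀ y : Fin (m + m) → Bool, (fun k => (b zeroVec ^^ b (bxor zeroVec s) ^^ b (bxor zeroVec y) ^^ b (bxor zeroVec (bxor s y))) ^^ (b (fun j => decide (j = k)) ^^ b (bxor (fun j => decide (j = k)) s) ^^ b (bxor (fun j => decide (j = k)) y) ^^ b (bxor (fun j => decide (j = k)) (bxor s y)))) ∈ U) ∧ (∀ s ∈ S, ∃ ℓ ∈ U, ∀ r : Fin (m + m) → Bool, (∀ y z : Fin (m + m) → Bool, ((b z ^^ b (bxor z s) ^^ b (bxor z r) ^^ b (bxor z (bxor s r))) ^^ (b (bxor z y) ^^ b (bxor (bxor z y) s)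 ^^ b (bxor (bxor z y) r) ^^ b (bxor (bxor z y) (bxor s r)))) = false) → (b r ^^ b (bxor r s) ^^ b zeroVec ^^ b s) = ((Finset.univ.filter fun i => ℓ i && r i).card).bodd))
    (hca : (∀ s ∈ U, ∀ y : Fin (m + m) → Bool, (fun k => (a zeroVec ^^ a (bxor zeroVec s) ^^ a (bxor zeroVec y) ^^ a (bxor zeroVec (bxor s y))) ^^ (a (fun j => decide (j = k)) ^^ a (bxor (fun j => decide (j = k)) s) ^^ a (bxor (fun j => decide (j = k)) y) ^^ a (bxor (fun j => decide (j = k)) (bxor s y)))) ∈ S) ∧ (∀ s ∈ U, ∃ ℓ ∈ S, ∀ r : Fin (m + m) → Bool, (∀ y z : Fin (m + m) → Bool, ((a z ^^ a (bxor z s) ^^ a (bxor z r) ^^ a (bxor z (bxor s r))) ^^ (a (bxor z y) ^^ a (bxor (bxor z y) s) ^^ a (bxor (bxor z y) r) ^^ a (bxor (bxor z y) (bxor s r)))) = false) → (a r ^^ a (bxor r s) ^^ a zeroVec ^^ a s) = ((Finset.univ.filter fun i => ℓ i && r i).card).bodd))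
    (ho : ∀ s ∈ S, ∀ u ∈ U, ((Finset.univ.filter fun i => s i && u i).card).bodd = false) :
    (∀ s ∈ S, (fun j => s (Fin.natAdd m j)) = zeroVec) ∧ (∀ u ∈ U, (fun i => u (Fin.castAdd m i)) = zeroVec) := by
  -- second differences of `b` and `a` as opaque functions
  obtain ⟨D, hD⟩ : ∃ D : (Fin (m + m) → Bool) → (Fin (m + m) → Bool) → (Fin (m + m) → Bool) → Bool,
      ∀ u v x, D u v x = (b x ^^ b (bxor x u) ^^ b (bxor x v) ^^ b (bxor x (bxor u v))) := ⟨_, fun _ _ _ => rfl⟩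
  obtain ⟨Da, hDa⟩ : ∃ Da : (Fin (m + m) → Bool) → (Fin (m + m) → Bool) → (Fin (m + m) → Bool) → Bool,
      ∀ u v x, Da u v x = (a x ^^ a (bxor x u) ^^ a (bxor x v) ^^ a (bxor x (bxor u v))) := ⟨_, fun _ _ _ => rfl⟩
  simp only [← hD] at hcb
  simp only [← hDa] at hca
  obtain ⟨hrow, hoff⟩ := hcb
  obtain ⟨hrowa, hoffa⟩ := hca
  have ho' : ∀ u ∈ U, ∀ s ∈ S, ((Finset.univ.filter fun i => u i && s i).card).bodd = false :=
    fun u hu s hs => by rw [bdot_comm]; exact ho s hs u hu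
  -- the `b`-frame `ι g = (g, 0)`, projection `pb X = X''`
  obtain ⟨ι, hι⟩ : ∃ ι : (Fin m → Bool) → (Fin (m + m) → Bool), ∀ g, ι g = Fin.append g zeroVec := ⟨_, fun _ => rfl⟩
  obtain ⟨pb, hpb⟩ : ∃ pb : (Fin (m + m) → Bool) → (Fin m → Bool), ∀ X, pb X = fun j => X (Fin.natAdd m j) :=
    ⟨_, fun _ => rfl⟩
  have hFb : ∀ (X : Fin (m + m) → Bool) (g : Fin m → Bool),
      (b X ^^ b (bxor X (ι g))) = (univ.filter fun i => g i && π (pb X) i).card.bodd := fun X g => by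
    rw [hι, hpb]; exact frameLaw_b hbdef X g
  have hpadd : ∀ X Y, pb (bxor X Y) = bxor (pb X) (pb Y) := fun X Y => by rw [hpb, hpb, hpb]
  have hsurj : ∀ t, ∃ X, pb X = t := fun t =>
    ⟨Fin.append zeroVec t, by rw [hpb]; funext j; exact Fin.append_right _ _ j⟩
  have hunit : ∀ i, ι (fun j => decide (j = i)) = fun j => decide (j = Fin.castAdd m i) := fun i => by
    rw [hι]; exact (unitVec_castAdd i).symm
  -- the `a`-frame `ιa r = (0, r)`, projection `pa X = X'`
  obtain ⟨ιa, hιa⟩ : ∃ ιa : (Fin m → Bool) → (Fin (m + m) → Bool), ∀ r, ιa r = Fin.append zeroVec r :=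
    ⟨_, fun _ => rfl⟩
  obtain ⟨pa, hpa⟩ : ∃ pa : (Fin (m + m) → Bool) → (Fin m → Bool), ∀ X, pa X = fun i => X (Fin.castAdd m i) :=
    ⟨_, fun _ => rfl⟩
  have hFa : ∀ (X : Fin (m + m) → Bool) (r : Fin m → Bool),
      (a X ^^ a (bxor X (ιa r))) = (univ.filter fun i => r i && π.symm (pa X) i).card.bodd := fun X r => by
    rw [hιa, hpa]; exact frameLaw_a hadef X r
  have hpa_add : ∀ X Y, pa (bxor X Y) = bxor (pa X) (pa Y) := fun X Y => by rw [hpa, hpa, hpa]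
  have hsurja : ∀ t, ∃ X, pa X = t := fun t =>
    ⟨Fin.append t zeroVec, by rw [hpa]; funext i; exact Fin.append_left _ _ i⟩
  have hunita : ∀ i, ιa (fun j => decide (j = i)) = fun j => decide (j = Fin.natAdd m i) := fun i => by
    rw [hιa]; exact (unitVec_natAdd i).symm
  -- Step 1: flatness of `S` for `b` and of `U` for `a`; isotropy of the projections
  have flatS : ∀ s ∈ S, ∀ s₂ ∈ S, ∀ x, D s s₂ x = false := flat_of_closed_orth hb D hD hrow hoff ho
  have flatU : ∀ u ∈ U, ∀ u₂ ∈ U, ∀ x, Da u u₂ x = false := flat_of_closed_orth ha Da hDa hrowa hoffa ho'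
  have isoS : ∀ s ∈ S, ∀ s₂ ∈ S, Bv π (pb s) (pb s₂) = zeroVec := by
    intro s hs s₂ hs₂
    refine CubeKS.eq_zeroVec_of_bdot _ fun g => ?_
    have key := frame_D3 D hD hπ hFb hpadd s s₂ zeroVec g
    rw [flatS s hs s₂ hs₂, flatS s hs s₂ hs₂] at key
    exact key.symm
  have isoU : ∀ u ∈ U, ∀ u₂ ∈ U, Bv π.symm (pa u) (pa u₂) = zeroVec := by
    intro u hu u₂ hu₂
    refine CubeKS.eq_zeroVec_of_bdot _ fun r => ?_
    have key := frame_D3 Da hDa hσ hFa hpa_add u u₂ zeroVec r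
    rw [flatU u hu u₂ hu₂, flatU u hu u₂ hu₂] at key
    exact key.symm
  -- Step 2: rows project into the other side's projection
  have rowU : ∀ s ∈ S, ∀ t, Bv π (pb s) t ∈ U.image (fun u i => u (Fin.castAdd m i)) :=
    frame_row_mem D hD hπ hFb hpadd hsurj hunit hrow
  have rowS : ∀ u ∈ U, ∀ t, Bv π.symm (pa u) t ∈ S.image (fun s j => s (Fin.natAdd m j)) :=
    frame_row_mem Da hDa hσ hFa hpa_add hsurja hunita hrowa
  -- Step 3: block nondegeneracy
  constructor
  · intro s hs
    rw [← hpb]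
    refine hnd1 (pb s) fun y y₂ => ?_
    obtain ⟨u, hu, hu'⟩ := mem_image.1 (rowU s hs y)
    obtain ⟨u₂, hu₂, hu₂'⟩ := mem_image.1 (rowU s hs y₂)
    have key := isoU u hu u₂ hu₂
    rw [hpa, hpa, hu', hu₂'] at key
    exact key
  · intro u hu
    rw [← hpa]
    refine hnd2 (pa u) fun x x₂ => ?_
    obtain ⟨s, hs, hs'⟩ := mem_image.1 (rowS u hu x)
    obtain ⟨s₂, hs₂, hs₂'⟩ := mem_image.1 (rowS u hu x₂)
    have key := isoS s hs s₂ hs₂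
    rw [hpb, hpb, hs', hs₂'] at key
    exact key

/-! ### A proper `⊕`-closed `S` misses a one-block frame vector -/

/-- **A proper subspace of the frame misses a block**: if `0 ∈ S`, `S` is `⊕`-closed and `|S| < 2^(3k)`, some frame
vector `((a)_q, 0)` supported in a single block is not in `S` (else `S ⊇ Y' × 0`, of size `2^(3k)`). [folklore] -/
theorem exists_block_notin {k : ℕ} {S : Finset (Fin (k * 3 + k * 3) → Bool)} (hS0 : zeroVec ∈ S)
    (hSadd : ∀ x ∈ S, ∀ y ∈ S, bxor x y ∈ S) (hSlt : S.card < 2 ^ (k * 3)) :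
    ∃ (q : Fin k) (a : Fin 3 → Bool), Fin.append (embed q a) zeroVec ∉ S := by
  classical
  by_contra hne
  push Not at hne
  have claim : ∀ (T : Finset (Fin k)) (y' : Fin (k * 3) → Bool), (∀ q, q ∉ T → blk y' q = zeroVec) →
      Fin.append y' zeroVec ∈ S := by
    intro T
    induction T using Finset.induction_on with
    | empty =>
      intro y' hy'
      have e : y' = zeroVec := eq_of_blk_eq fun q => by rw [blk_zeroVec]; exact hy' q (Finset.notMem_empty q)
      rw [e, append_zeroVec]
      exact hS0
    | insert q T hq ih =>
      intro y' hy'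
      have h1 : Fin.append (bxor y' (embed q (blk y' q))) zeroVec ∈ S := by
        refine ih _ fun q' hq' => ?_
        rw [blk_bxor, blk_embed]
        by_cases hqq : q' = q
        · rw [if_pos hqq, hqq, bxor_self]
        · rw [if_neg hqq, bxor_zeroVec]
          exact hy' q' (by rw [Finset.mem_insert]; push Not; exact ⟨hqq, hq'⟩)
      have h2 := hSadd _ h1 _ (hne q (blk y' q))
      rw [bxor_append, bxor_zeroVec] at h2
      have e : bxor (bxor y' (embed q (blk y' q))) (embed q (blk y' q)) = y' := by
        funext i
        show ((y' i ^^ embed q (blk y' q) i) ^^ embed q (blk y' q) i) = y' i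
        cases y' i <;> cases embed q (blk y' q) i <;> rfl
      rwa [e] at h2
  have hall : ∀ y' : Fin (k * 3) → Bool, Fin.append y' zeroVec ∈ S :=
    fun y' => claim Finset.univ y' fun q hq => absurd (Finset.mem_univ q) hq
  have hsub : (Finset.univ : Finset (Fin (k * 3) → Bool)).image (fun y' => Fin.append y' zeroVec) ⊆ S := by
    intro x hx
    obtain ⟨y', -, rfl⟩ := Finset.mem_image.1 hx
    exact hall y'
  have hcard := Finset.card_le_card hsub
  rw [Finset.card_image_of_injective _ append_zero_injective, Finset.card_univ, Fintype.card_fun,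
    Fintype.card_bool, Fintype.card_fin] at hcard
  omega

end CubeBS

end Summit.QuantumAdvantage.QuantumAdvantage.Theorems.SignedExactCubicForrelationNotPrBPP
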